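/-
Copyright (c) 2026 the pub-hodgecm-mathlib formalisation cell (harness21).  Prover seat hodgecm-mathlib-LH4-p08 (g2), req620 Track A «(D-RAM) FOUR-FRAME» squad, unit U3_Laws (iii),
MS ROAD STAGE B (Stage B lead LH4-p10 (g2), MS ledger LH4-p11; dealer LH4-plan (g11)): B56-ASSEMBLY `stub_B56_G1` (skeleton `B10-StableCountTypeZero.SKELETON.v1` c61f53438acbd4dd :84),
FILE F3a «ON THE GLUE FOOT: stability in `κ`-currency and the count of glue classes».  The glue-class count is ADAPTED from LH4-p07 (g3)'s twin at `s = 0`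
(`F0P3cDyRamDiagonalCoreHangingFoot.ncard_glue_representatives_eq`, HOME cand 2026-09-04), itself over LH4-p10 (g2)'s ★ B6 fixed-ball index.  2026-09-04.
-/
import Summits.HodgeConjecture.HodgeConjecture.Theorems.F0P3cDyRamDiagonalGluedStabiliserMembership  -- ★ p855806 (this seat): `pow_mul_le_pow_add_iff`
import Summits.HodgeConjecture.HodgeConjecture.Theorems.F0P3cDyRamDiagonalGluedStabiliserIndex       -- ★ (F0P3-p01 (g31)): `ne_zero_and_v_lt_one_of_v_eq_exp`
import Summits.HodgeConjecture.HodgeConjecture.Theorems.F0P3cDyRamDiagonalGlueShellCount             -- ★ p855870 B6 (LH4-p10 (g2)): `relIndex_ball_fixedBall_sup_ball`; brings ★ B5 (ii) `mapGL_latt_hnf_glued_eq_iff`, ★ B1 `mem_fixedSubgroup_iff`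
import HarnessLib

/-!
# Crux `H413`, MS ROAD STAGE B, B56-ASSEMBLY FILE F3a: the glued stratum ON THE GLUE FOOT `n₁ = n₂ + 2t`, `n₂ = n₃ = m`, `ρ ≤ m < 2ρ` — stability reads `|κ + g₀| ≤ |ϖ|^{2ρ+2t−m}`
# (`κ = y″∕(xζ)`, glue unit `g₀ = (β−1)∕(α−1)`), and the glue classes of `κ` number `q^{⌈(ρ+2t)∕2⌉ − ⌈e∕2⌉}` (`e = 2ρ + 2t − m`) or NONE

Cell `hodgecm-mathlib` (D-0151), FLOOR 0, crux item H413 = `stmt-HodgeConjecture-24833`; lane `--supports stmt-HodgeConjecture-24833 --as helper` (count-neutral).  THEOREMS ONLY (no `def`,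
no instance, no notation, no `sorry`, default heartbeats).  LH4-p10 (g2) MEMO v2 §4 (GG) ∕ SPEC v2-B5split «B6 note».
* §1 **`mapGL_latt_glued_eq_iff_kappa`** — for `T = diag(α, β, 1)` on the foot (`|β − 1| = |ϖ|^{m+2t}`, `|α − 1| = |β − α| = |ϖ|^m`, `ρ ≤ m ≤ 2ρ + 2t`) and a glued `V(x,ζ,y″)` (`|x| = |ζ| = 1`):
  `T·latt V = latt V ⟺ |y″∕(xζ) + (β−1)∕(α−1)| ≤ |ϖ|^{2ρ+2t−m}` (★ B5 (ii) `mapGL_latt_hnf_glued_eq_iff`: the first two congruences hold, the third factors through `(α−1)xζ`).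
* §2 **`ncard_glue_representatives_eq`** — for an irredundant complete system `R` of the fixed elements of valuation `|ϖ|^{2t}` modulo `𝔭^{ρ+2t}` (★ (iv-c)), `|g₀| = |ϖ|^{2t}`, `2t < e ≤ ρ + 2t`, and a
  fixed `f₀` with `|f₀ + g₀| ≤ |ϖ|^e`: `#{g ∈ R : |g + g₀| ≤ |ϖ|^e} = q^{⌈(ρ+2t)∕2⌉ − ⌈e∕2⌉}` — the classes `g − f₀` run over `((𝒪_F ∩ 𝔭^e) + 𝔭^{ρ+2t})∕𝔭^{ρ+2t}`, counted by ★ B6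
  `relIndex_ball_fixedBall_sup_ball`; `glue_representatives_eq_empty` — no such `f₀` ⇒ no such class (adapted from LH4-p07 (g3)'s `s = 0` twin).
HONEST LABEL.  Count-neutral; nothing printed is asserted; the census laws stay PROVER TARGETS; `HC_CM` is proved only modulo the 7 printed citations (2 remaining named inputs: hLiu418 =
`stmt-HodgeConjecture-24832`, h413 = `stmt-HodgeConjecture-24833`) until rung 0 closes.

## References
* [Kottwitz1986BaseChangeUnits] R. Kottwitz, *Base change for unit elements of Hecke algebras*, Compositio Math. 60 (1986), §1 pp. 240–241 (fixed-lattice counts via torus orbits).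
* [Serre1979] J.-P. Serre, *Local Fields*, GTM 67 (1979), Ch. IV §2 Prop. 6; Ch. I §6 Prop. 18 (unit filtration counts; the fixed subring of a ramified quadratic extension).
-/

set_option autoImplicit false

noncomputable section

namespace Summit.HodgeConjecture.HodgeConjecture.Cruxes.H413.F0P3cDyRamDiagonalGluedFootClasses

open Matrix WithZero
open Literature.NumberTheory.Automorphic Literature.NumberTheory.Automorphic.HermitianLattice
open Literature.NumberTheory.Automorphic.UnitaryLatticeTree
open Literature.NumberTheory.LocalFields.WildQuadraticDatum
open Summit.HodgeConjecture.HodgeConjecture.Cruxes.H413.F0P3cDyRamDiagonalTorusDefs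
open Summit.HodgeConjecture.HodgeConjecture.Cruxes.H413.F0P3cDyRamDiagonalGluedStabiliserMembership (pow_mul_le_pow_add_iff)
open Summit.HodgeConjecture.HodgeConjecture.Cruxes.H413.F0P3cDyRamDiagonalGluedStabiliserIndex (ne_zero_and_v_lt_one_of_v_eq_exp)
open Summit.HodgeConjecture.HodgeConjecture.Cruxes.H413.F0P3cDyRamDiagonalGluedStability (mapGL_latt_hnf_glued_eq_iff)
open Summit.HodgeConjecture.HodgeConjecture.Cruxes.H413.F0P3cDyRamDiagonalGlueShellCount (relIndex_ball_fixedBall_sup_ball)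
open scoped Valued WithZero Matrix MatrixGroups

variable {K : Type*} [Field K] [Valued K ℤᵐ⁰]

/-! ## §1 Stability on the glue foot, in `κ`-currency -/

/-- **STABILITY ON THE GLUE FOOT** (`|β−1| = |ϖ|^{m+2t}`, `|α−1| = |β−α| = |ϖ|^m`, `ρ ≤ m ≤ 2ρ + 2t`): a glued `V(x,ζ,y″)` is `T`-stable iff `|y″∕(xζ) + (β−1)∕(α−1)| ≤ |ϖ|^{2ρ+2t−m}` — the first two
congruences of ★ B5 (ii) hold (`m ≥ ρ`, `m + 2t ≥ ρ + 2t`) and the third, `|(β−1)xζ + (α−1)y″| ≤ |ϖ|^{2ρ+2t}`, factors as `|α−1|·|xζ|·|κ + g₀|`.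
[cite: Kottwitz1986BaseChangeUnits, §1 pp. 240–241] -/
theorem mapGL_latt_glued_eq_iff_kappa {ϖ : K} (hϖ : Valued.v ϖ = exp (-1 : ℤ)) {α β : K} (hα : Valued.v α = 1) (hβ : Valued.v β = 1)
    (T : GL (Fin 3) K) (hT : (T : Matrix (Fin 3) (Fin 3) K) = Matrix.diagonal ![α, β, 1]) {m t : ℕ}
    (h₁ : Valued.v (β - 1) = Valued.v ϖ ^ (m + 2 * t)) (h₂ : Valued.v (α - 1) = Valued.v ϖ ^ m) (h₃ : Valued.v (β - α) = Valued.v ϖ ^ m)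
    {ρ : ℕ} (hρm : ρ ≤ m) (hm : m ≤ 2 * ρ + 2 * t) {x ζ y'' : K} (hx : Valued.v x = 1) (hζ : Valued.v ζ = 1) (V : GL (Fin 3) K)
    (hV : (V : Matrix (Fin 3) (Fin 3) K) = !![1, 0, 0; x, ϖ ^ ρ, 0; x * ζ + y'', ϖ ^ ρ * ζ, ϖ ^ (2 * ρ + 2 * t)]) :
    mapGL T (latt (V : Matrix (Fin 3) (Fin 3) K)) = latt (V : Matrix (Fin 3) (Fin 3) K) ↔
      Valued.v (y'' / (x * ζ) + (β - 1) / (α - 1)) ≤ Valued.v ϖ ^ (2 * ρ + 2 * t - m) := by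
  obtain ⟨hϖ0, -⟩ := ne_zero_and_v_lt_one_of_v_eq_exp hϖ
  have hvϖ0 : Valued.v ϖ ≠ 0 := (Valuation.ne_zero_iff _).2 hϖ0
  have hα1 : α - 1 ≠ 0 := fun h => by rw [h, map_zero] at h₂; exact pow_ne_zero m hvϖ0 h₂.symm
  have hx0 : x ≠ 0 := (Valuation.ne_zero_iff _).1 (by rw [hx]; exact one_ne_zero)
  have hζ0 : ζ ≠ 0 := (Valuation.ne_zero_iff _).1 (by rw [hζ]; exact one_ne_zero)
  rw [mapGL_latt_hnf_glued_eq_iff hϖ0 hα hβ T hT ρ (2 * t) x ζ y'' V hV]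
  have c1 : Valued.v ((β - α) * x) ≤ Valued.v ϖ ^ ρ := by
    rw [map_mul, hx, mul_one, h₃]; exact (v_pow_le_v_pow_iff hϖ _ _).2 hρm
  have c2 : Valued.v ((β - 1) * ζ) ≤ Valued.v ϖ ^ (ρ + 2 * t) := by
    rw [map_mul, hζ, mul_one, h₁]; exact (v_pow_le_v_pow_iff hϖ _ _).2 (by omega)
  have hfac : (β - 1) * x * ζ + (α - 1) * y'' = (α - 1) * (x * ζ) * (y'' / (x * ζ) + (β - 1) / (α - 1)) := by
    field_simp
    ring
  have hsplit : Valued.v ϖ ^ (2 * ρ + 2 * t) = Valued.v ϖ ^ (m + (2 * ρ + 2 * t - m)) := by rw [Nat.add_sub_cancel' hm]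
  simp only [c1, c2, true_and]
  rw [hfac, map_mul, map_mul, map_mul, hx, hζ, mul_one, mul_one, h₂, hsplit, pow_mul_le_pow_add_iff hϖ0]

/-! ## §2 The glue classes of `κ` -/

/-- **THE NUMBER OF GLUE CLASSES** (twin of LH4-p07 (g3)'s `s = 0` count): `R` an irredundant complete system of representatives of the `σ`-fixed elements of valuation `|ϖ|^{2t}` modulo
`𝔭^{ρ+2t}`, `|g₀| = |ϖ|^{2t}`, `2t < e ≤ ρ + 2t`, and SOME fixed `f₀` with `|f₀ + g₀| ≤ |ϖ|^e`: then `#{g ∈ R : |g + g₀| ≤ |ϖ|^e} = q^{⌈(ρ+2t)∕2⌉ − ⌈e∕2⌉}` — `g ↦ g − f₀` is a bijection onto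
`((𝒪_F ∩ 𝔭^e) + 𝔭^{ρ+2t})∕𝔭^{ρ+2t}` (★ B6 `relIndex_ball_fixedBall_sup_ball`). [cite: Kottwitz1986BaseChangeUnits, §1 pp. 240–241] [cite: Serre1979, Ch. IV §2 Prop. 6] -/
theorem ncard_glue_representatives_eq {σ : K →+* K} {ϖ : K} {d : ℕ} (hσ : ∀ x, σ (σ x) = x) (hvσ : ∀ a, Valued.v (σ a) = Valued.v a)
    (hfix : ∀ x : K, σ x = x → x ≠ 0 → ∃ n : ℤ, Valued.v x = exp (2 * n)) (hϖ : Valued.v ϖ = exp (-1 : ℤ))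
    (hd : Valued.v (ϖ - σ ϖ) = Valued.v ϖ ^ d) [Finite 𝓀[K]] {ρ t e : ℕ} (hte : 2 * t < e) (heρ : e ≤ ρ + 2 * t) {R : Set K} (hRfin : R.Finite)
    (hR1 : ∀ g ∈ R, σ g = g ∧ Valued.v g = Valued.v ϖ ^ (2 * t))
    (hR2 : ∀ f : K, σ f = f → Valued.v f = Valued.v ϖ ^ (2 * t) → ∃ g ∈ R, Valued.v (f - g) ≤ Valued.v ϖ ^ (ρ + 2 * t))
    (hR3 : ∀ g ∈ R, ∀ g' ∈ R, Valued.v (g - g') ≤ Valued.v ϖ ^ (ρ + 2 * t) → g = g') {g₀ : K} (hg₀ : Valued.v g₀ = Valued.v ϖ ^ (2 * t))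
    {f₀ : K} (hσf₀ : σ f₀ = f₀) (hf₀ : Valued.v (f₀ + g₀) ≤ Valued.v ϖ ^ e) :
    {g ∈ R | Valued.v (g + g₀) ≤ Valued.v ϖ ^ e}.ncard = Nat.card 𝓀[K] ^ ((ρ + 2 * t + 1) / 2 - (e + 1) / 2) := by
  -- adapted from LH4-p07 (g3), `F0P3cDyRamDiagonalCoreHangingFoot.ncard_glue_representatives_eq` (s = 0)
  classical
  have hϖe : Valued.v ϖ ^ e = exp (-(e : ℤ)) := v_varpi_pow hϖ e
  have hϖn : Valued.v ϖ ^ (ρ + 2 * t) = exp (-((ρ + 2 * t : ℕ) : ℤ)) := v_varpi_pow hϖ (ρ + 2 * t)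
  have hϖe1 : Valued.v ϖ ^ e < Valued.v ϖ ^ (2 * t) := by rw [hϖe, v_varpi_pow hϖ, exp_lt_exp]; omega
  have hne : Valued.v ϖ ^ (ρ + 2 * t) ≤ Valued.v ϖ ^ e := by rw [hϖe, hϖn, exp_le_exp]; omega
  -- `|f₀| = |ϖ|^{2t}`
  have hvf₀ : Valued.v f₀ = Valued.v ϖ ^ (2 * t) := by
    have e1 : f₀ = (f₀ + g₀) + -g₀ := by ring
    rw [e1, Valuation.map_add_eq_of_lt_right _ (by rw [Valuation.map_neg, hg₀]; exact hf₀.trans_lt hϖe1), Valuation.map_neg, hg₀]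
  -- the subgroups
  set Fx : AddSubgroup K := (σ.toAddMonoidHom - AddMonoidHom.id K).ker with hFx
  set Be : AddSubgroup K := (Valued.v : Valuation K ℤᵐ⁰).leAddSubgroup (exp (-(e : ℤ))) with hBe
  set Bn : AddSubgroup K := (Valued.v : Valuation K ℤᵐ⁰).leAddSubgroup (exp (-((ρ + 2 * t : ℕ) : ℤ))) with hBn
  set H : AddSubgroup K := (Fx ⊓ Be) ⊔ Bn with hH
  have hidx : Bn.relIndex H = Nat.card 𝓀[K] ^ ((ρ + 2 * t + 1) / 2 - (e + 1) / 2) := relIndex_ball_fixedBall_sup_ball hσ hvσ hfix hϖ hd heρ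
  set Rg : Set K := {g ∈ R | Valued.v (g + g₀) ≤ Valued.v ϖ ^ e} with hRg
  -- `g − f₀ ∈ Fx ⊓ Be ≤ H` for `g ∈ Rg`
  have hmemH : ∀ g ∈ Rg, g - f₀ ∈ H := by
    rintro g ⟨hgR, hg⟩
    refine AddSubgroup.mem_sup_left (AddSubgroup.mem_inf.2 ⟨(mem_fixedSubgroup_iff _).2 (by rw [map_sub, (hR1 g hgR).1, hσf₀]), ?_⟩)
    rw [hBe, Valuation.mem_leAddSubgroup_iff, ← hϖe, show g - f₀ = (g + g₀) - (f₀ + g₀) by ring]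
    exact Valuation.map_sub_le _ hg hf₀
  let ψ : Rg → H ⧸ Bn.addSubgroupOf H := fun g => QuotientAddGroup.mk ⟨(g : K) - f₀, hmemH g g.2⟩
  have hψ : Function.Bijective ψ := by
    constructor
    · intro g g' h
      apply Subtype.ext
      change (QuotientAddGroup.mk (⟨(g : K) - f₀, hmemH g g.2⟩ : H) : H ⧸ Bn.addSubgroupOf H) = QuotientAddGroup.mk ⟨(g' : K) - f₀, hmemH g' g'.2⟩ at h
      rw [QuotientAddGroup.eq, AddSubgroup.mem_addSubgroupOf, hBn] at h
      change -((g : K) - f₀) + ((g' : K) - f₀) ∈ (Valued.v : Valuation K ℤᵐ⁰).leAddSubgroup (exp (-((ρ + 2 * t : ℕ) : ℤ))) at h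
      rw [Valuation.mem_leAddSubgroup_iff, ← hϖn, show -((g : K) - f₀) + ((g' : K) - f₀) = (g' : K) - g by ring, Valuation.map_sub_swap] at h
      exact hR3 _ g.2.1 _ g'.2.1 h
    · intro q
      induction q using QuotientAddGroup.induction_on with
      | H h =>
        obtain ⟨δ, hδ, b, hb, hδb⟩ := AddSubgroup.mem_sup.1 h.2
        obtain ⟨hδF, hδe⟩ := AddSubgroup.mem_inf.1 hδ
        rw [mem_fixedSubgroup_iff] at hδF
        rw [hBe, Valuation.mem_leAddSubgroup_iff, ← hϖe] at hδe
        rw [hBn, Valuation.mem_leAddSubgroup_iff, ← hϖn] at hb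
        -- the fixed element `f₀ + δ` of valuation `|ϖ|^{2t}` and its representative
        have hvf : Valued.v (f₀ + δ) = Valued.v ϖ ^ (2 * t) := by
          rw [Valuation.map_add_eq_of_lt_left _ (by rw [hvf₀]; exact hδe.trans_lt hϖe1), hvf₀]
        obtain ⟨g, hgR, hfg⟩ := hR2 (f₀ + δ) (by rw [map_add, hσf₀, hδF]) hvf
        have hgRg : g ∈ Rg := by
          refine ⟨hgR, ?_⟩
          rw [show g + g₀ = -((f₀ + δ) - g) + δ + (f₀ + g₀) by ring]
          refine Valuation.map_add_le _ (Valuation.map_add_le _ ?_ hδe) hf₀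
          rw [Valuation.map_neg]; exact hfg.trans hne
        refine ⟨⟨g, hgRg⟩, ?_⟩
        change (QuotientAddGroup.mk (⟨g - f₀, hmemH g hgRg⟩ : H) : H ⧸ Bn.addSubgroupOf H) = QuotientAddGroup.mk h
        rw [QuotientAddGroup.eq, AddSubgroup.mem_addSubgroupOf, hBn]
        change -(g - f₀) + (h : K) ∈ (Valued.v : Valuation K ℤᵐ⁰).leAddSubgroup (exp (-((ρ + 2 * t : ℕ) : ℤ)))
        rw [Valuation.mem_leAddSubgroup_iff, ← hϖn, ← hδb, show -(g - f₀) + (δ + b) = ((f₀ + δ) - g) + b by ring]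
        exact Valuation.map_add_le _ hfg hb
  have hRgfin : Rg.Finite := hRfin.subset (Set.sep_subset _ _)
  haveI : Finite Rg := hRgfin.to_subtype
  rw [← Nat.card_coe_set_eq, Nat.card_congr (Equiv.ofBijective ψ hψ), ← AddSubgroup.index_eq_card]
  exact hidx

omit [Valued K ℤᵐ⁰] in
/-- … and there are NO glue classes if no fixed element is `𝔭^e`-close to `−g₀` (every representative is fixed). [cite: Kottwitz1986BaseChangeUnits, §1 pp. 240–241] -/
theorem glue_representatives_eq_empty [Valued K ℤᵐ⁰] {σ : K →+* K} {ϖ : K} {t e : ℕ} {R : Set K}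
    (hR1 : ∀ g ∈ R, σ g = g ∧ Valued.v g = Valued.v ϖ ^ (2 * t)) {g₀ : K}
    (hno : ¬ ∃ f : K, σ f = f ∧ Valued.v (f + g₀) ≤ Valued.v ϖ ^ e) :
    {g ∈ R | Valued.v (g + g₀) ≤ Valued.v ϖ ^ e} = ∅ :=
  Set.eq_empty_of_forall_notMem fun g ⟨hgR, hg⟩ => hno ⟨g, (hR1 g hgR).1, hg⟩

end Summit.HodgeConjecture.HodgeConjecture.Cruxes.H413.F0P3cDyRamDiagonalGluedFootClasses

end
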